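import Literature.Topology.FourManifolds.NonSeparatingSpheresStandardizeCircle
import Literature.Topology.FourManifolds.NonSeparatingSpheresTransversePoint
import Literature.Topology.FourManifolds.NonSeparatingSpheresShear
import HarnessLib

/-!
# Budney–Gabai Thm. 3.13: a non-separating sphere of `S¹ × Sⁿ` is flat over a tube about a dual
# circle, `n ≥ 3`

Fact seat of `Literature.Topology.FourManifolds.BudneyGabai2019_thm_3_13` (R. Budney, D. Gabai,
*Knotted 3-balls in `S⁴`*, arXiv:1912.09029, Thm. 3.13).  This file assembles sentences 1–3 of the
printed proof (p. 22) — the dual circle and its degree (`NonSeparatingSpheresDegree.lean`), its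
standardisation to `S¹ × {p₀}` by a diffeomorphism (`NonSeparatingSpheresStandardizeCircle.lean`:
Whitney + isotopy extension, `n ≥ 3`), transversality of the unique crossing
(`NonSeparatingSpheresTransversePoint.lean`) and the shear straightening over a tube
(`NonSeparatingSpheresGraph.lean`, `NonSeparatingSpheresShear.lean`) — into:

* `BudneyGabai2019_thm_3_13.exists_diffeomorph_flat_over_tube` — for a smoothly embedded
  `n`-sphere `e : Sⁿ → S¹ × Sⁿ`, `n ≥ 3`, with connected complement and points `x₀, p₀ ∈ Sⁿ`, there
  are a diffeomorphism `Ψ` of `S¹ × Sⁿ` and `r > 0` such that the (smoothly embedded, non-separating)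
  sphere `Ψ ∘ e` meets the closed tube `S¹ × B̄(p₀, r)` about the circle `S¹ × {p₀}` exactly in
  the flat disc `{1} × B̄(p₀, r)`, with `Ψ (e x₀) = (1, p₀)`.

*"If we drill a neighbourhood of `S¹ × {*}` out of `S¹ × Sⁿ` we have constructed `S¹ × Bⁿ`, and
our non-separating sphere is converted to a reducing ball"* (loc. cit.): after this theorem,
removing the open tube `S¹ × B(p₀, r)` leaves the properly embedded `n`-ball
`Ψ(e(Sⁿ)) ∖ ({1} × B(p₀, r))` in `S¹ × (Sⁿ ∖ B(p₀, r)) ≅ S¹ × Bⁿ`, with boundary the standard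
sphere `{1} × ∂B̄(p₀, r)`.  The remaining step of the printed proof is Budney–Gabai's Thm. 3.12
(uniqueness of reducing balls), not formalized here;
`BudneyGabai2019_thm_3_13.exists_image_eq_range_standardSphere_of_reducingBall` records the
resulting reduction of Thm. 3.13 (`n ≥ 3`, standard-target form) to it.

Everything here is proved; no definition and no named fact is introduced.

## References

* R. Budney, D. Gabai, *Knotted 3-balls in `S⁴`*, arXiv:1912.09029 (v2), §3, Thm. 3.13 and its
  proof (p. 22). [BudneyGabai2019]
-/

noncomputable section

open scoped Manifold ContDiff Topology Real
open Set Function Metric Module Filter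

namespace Literature.Topology.FourManifolds

namespace BudneyGabai2019_thm_3_13

variable {n : ℕ}

/-- The differential of a self-diffeomorphism of `S¹ × Sⁿ` is injective at every point (its
inverse differentiates to a left inverse). [folklore] -/
theorem injective_mfderiv_diffeomorph
    (Ψ : (Circle × Metric.sphere (0 : EuclideanSpace ℝ (Fin (n + 1))) 1) ≃ₘ⟮(𝓡 1).prod (𝓡 n),
        (𝓡 1).prod (𝓡 n)⟯ (Circle × Metric.sphere (0 : EuclideanSpace ℝ (Fin (n + 1))) 1))
    (q : Circle × Metric.sphere (0 : EuclideanSpace ℝ (Fin (n + 1))) 1) :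
    Injective (mfderiv ((𝓡 1).prod (𝓡 n)) ((𝓡 1).prod (𝓡 n)) Ψ q) := by
  have h1 : mfderiv ((𝓡 1).prod (𝓡 n)) ((𝓡 1).prod (𝓡 n)) (Ψ.symm ∘ Ψ) q =
      (mfderiv ((𝓡 1).prod (𝓡 n)) ((𝓡 1).prod (𝓡 n)) Ψ.symm (Ψ q)).comp
        (mfderiv ((𝓡 1).prod (𝓡 n)) ((𝓡 1).prod (𝓡 n)) Ψ q) :=
    mfderiv_comp q (Ψ.symm.contMDiff.mdifferentiableAt (by simp))
      (Ψ.contMDiff.mdifferentiableAt (by simp))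
  have h2 : mfderiv ((𝓡 1).prod (𝓡 n)) ((𝓡 1).prod (𝓡 n)) (Ψ.symm ∘ Ψ) q =
      ContinuousLinearMap.id ℝ (TangentSpace ((𝓡 1).prod (𝓡 n)) q) := by
    have : (Ψ.symm ∘ Ψ : Circle × Metric.sphere (0 : EuclideanSpace ℝ (Fin (n + 1))) 1 →
        Circle × Metric.sphere (0 : EuclideanSpace ℝ (Fin (n + 1))) 1) = id :=
      funext Ψ.symm_apply_apply
    rw [this, mfderiv_id]
  have h3 : Injective (mfderiv ((𝓡 1).prod (𝓡 n)) ((𝓡 1).prod (𝓡 n)) (Ψ.symm ∘ Ψ) q) := by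
    rw [h2]
    exact injective_id
  rw [h1] at h3
  have key : Injective (⇑(mfderiv ((𝓡 1).prod (𝓡 n)) ((𝓡 1).prod (𝓡 n)) Ψ.symm (Ψ q)) ∘
      ⇑(mfderiv ((𝓡 1).prod (𝓡 n)) ((𝓡 1).prod (𝓡 n)) Ψ q)) := h3
  exact key.of_comp

/-- **A non-separating sphere of `S¹ × Sⁿ`, `n ≥ 3`, is flat over a tube about a dual circle, up to
a diffeomorphism** (Budney–Gabai 2019, proof of Thm. 3.13, sentences 1–3).  For a smoothly embedded
`n`-sphere `e : Sⁿ → S¹ × Sⁿ`, `n ≥ 3`, whose image has connected complement, and `x₀, p₀ ∈ Sⁿ`,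
there are a diffeomorphism `Ψ` of `S¹ × Sⁿ` and `r > 0` such that `Ψ ∘ e` (again a smooth
embedding with connected complement) satisfies `Ψ (e x₀) = (1, p₀)` and meets the closed tube
`S¹ × B̄(p₀, r)` exactly in the flat `n`-disc `{1} × B̄(p₀, r)`; in particular it meets the circle
`S¹ × {p₀}` exactly once.  (Dual circle of degree `±1`, isotoped onto `S¹ × {p₀}` by Whitney's
theorem and isotopy extension; transversality of the crossing makes the sphere a graph over the
`Sⁿ`-factor near it, which a fibre-preserving shear flattens.)
[cite: BudneyGabai2019, proof of Thm. 3.13 (arXiv:1912.09029 v2, p. 22)] -/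
theorem exists_diffeomorph_flat_over_tube (hn : 3 ≤ n)
    {e : Metric.sphere (0 : EuclideanSpace ℝ (Fin (n + 1))) 1 →
      Circle × Metric.sphere (0 : EuclideanSpace ℝ (Fin (n + 1))) 1}
    (he : Manifold.IsSmoothEmbedding (𝓡 n) ((𝓡 1).prod (𝓡 n)) ∞ e)
    (hconn : IsConnected (range e)ᶜ)
    (x₀ p₀ : Metric.sphere (0 : EuclideanSpace ℝ (Fin (n + 1))) 1) :
    ∃ (Ψ : (Circle × Metric.sphere (0 : EuclideanSpace ℝ (Fin (n + 1))) 1) ≃ₘ⟮(𝓡 1).prod (𝓡 n),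
        (𝓡 1).prod (𝓡 n)⟯ (Circle × Metric.sphere (0 : EuclideanSpace ℝ (Fin (n + 1))) 1)) (r : ℝ),
      0 < r ∧ Manifold.IsSmoothEmbedding (𝓡 n) ((𝓡 1).prod (𝓡 n)) ∞ (Ψ ∘ e) ∧
      IsConnected (range (Ψ ∘ e))ᶜ ∧ Ψ (e x₀) = (1, p₀) ∧
      range (Ψ ∘ e) ∩ {q | q.2 ∈ closedBall p₀ r} = {(1 : Circle)} ×ˢ closedBall p₀ r := by
  -- ### sentences 1–2: dual circle, standardised
  obtain ⟨c, s₀, a, d, Ψ₁, -, hcs₀, hcoff, ⟨γ, hγs, -, hγimm, hγ0, hγtr, U, hU, hUeq⟩, hd, hΨc⟩ :=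
    exists_diffeomorph_dualCircle_standard hn he hconn x₀ p₀
  set e' : Metric.sphere (0 : EuclideanSpace ℝ (Fin (n + 1))) 1 →
      Circle × Metric.sphere (0 : EuclideanSpace ℝ (Fin (n + 1))) 1 := Ψ₁ ∘ e with he'def
  have he' : Manifold.IsSmoothEmbedding (𝓡 n) ((𝓡 1).prod (𝓡 n)) ∞ e' :=
    isSmoothEmbedding_diffeomorph_comp_circleProdSphere Ψ₁ he
  have heinj : Injective e := he.isEmbedding.injective
  -- the standard circle is `Ψ₁ ∘ c`
  have hstd : ∀ q : Circle × Metric.sphere (0 : EuclideanSpace ℝ (Fin (n + 1))) 1, q.2 = p₀ →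
      ∃ s, Ψ₁ (c s) = q := by
    intro q hq
    have hmem : q ∈ (univ : Set Circle) ×ˢ
        ({p₀} : Set (Metric.sphere (0 : EuclideanSpace ℝ (Fin (n + 1))) 1)) := ⟨mem_univ _, hq⟩
    rw [← range_standardLoop a hd p₀] at hmem
    obtain ⟨s, hs⟩ := hmem
    exact ⟨s, (hΨc s).trans hs⟩
  have hx₀' : (e' x₀).2 = p₀ := by
    show (Ψ₁ (e x₀)).2 = p₀
    rw [← hcs₀, hΨc]
  have hcross' : ∀ x, (e' x).2 = p₀ → x = x₀ := by
    intro x hx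
    obtain ⟨s, hs⟩ := hstd (e' x) hx
    have hcs : c s = e x := Ψ₁.injective hs
    have hs₀ : s = s₀ := by
      by_contra h
      exact hcoff s h ⟨x, hcs.symm⟩
    rw [hs₀, hcs₀] at hcs
    exact (heinj hcs).symm
  -- ### transversality at the crossing, transported by `Ψ₁`
  set γ' : ℝ → Circle × Metric.sphere (0 : EuclideanSpace ℝ (Fin (n + 1))) 1 := Ψ₁ ∘ γ with hγ'def
  have hγ's : ContMDiff 𝓘(ℝ, ℝ) ((𝓡 1).prod (𝓡 n)) ∞ γ' := Ψ₁.contMDiff.comp hγs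
  set L := mfderiv ((𝓡 1).prod (𝓡 n)) ((𝓡 1).prod (𝓡 n)) Ψ₁ (e x₀) with hLdef
  have hLinj : Injective L := injective_mfderiv_diffeomorph Ψ₁ (e x₀)
  have hchainγ : mfderiv 𝓘(ℝ, ℝ) ((𝓡 1).prod (𝓡 n)) γ' 0 =
      L.comp (mfderiv 𝓘(ℝ, ℝ) ((𝓡 1).prod (𝓡 n)) γ 0) := by
    rw [hLdef, ← hγ0]
    exact mfderiv_comp 0 (Ψ₁.contMDiff.mdifferentiableAt (by simp))
      ((hγs 0).mdifferentiableAt (by simp))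
  have hchaine : mfderiv (𝓡 n) ((𝓡 1).prod (𝓡 n)) e' x₀ =
      L.comp (mfderiv (𝓡 n) ((𝓡 1).prod (𝓡 n)) e x₀) :=
    mfderiv_comp x₀ (Ψ₁.contMDiff.mdifferentiableAt (by simp))
      (he.contMDiff.mdifferentiableAt (by simp))
  have hγ'imm : Injective (mfderiv 𝓘(ℝ, ℝ) ((𝓡 1).prod (𝓡 n)) γ' 0) := by
    rw [hchainγ]
    have key : Injective (⇑L ∘ ⇑(mfderiv 𝓘(ℝ, ℝ) ((𝓡 1).prod (𝓡 n)) γ 0)) := hLinj.comp (hγimm 0)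
    exact key
  have hγ'tr : (mfderiv 𝓘(ℝ, ℝ) ((𝓡 1).prod (𝓡 n)) γ' 0 (1 : ℝ) :
      EuclideanSpace ℝ (Fin 1) × EuclideanSpace ℝ (Fin n)) ∉
        (mfderiv (𝓡 n) ((𝓡 1).prod (𝓡 n)) e' x₀).range := by
    rw [hchainγ, hchaine]
    rintro ⟨w, hw⟩
    apply hγtr
    refine ⟨w, ?_⟩
    have hw' : L (mfderiv (𝓡 n) ((𝓡 1).prod (𝓡 n)) e x₀ w) =
        L (mfderiv 𝓘(ℝ, ℝ) ((𝓡 1).prod (𝓡 n)) γ 0 (1 : ℝ)) := hw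
    exact hLinj hw'
  -- the arc runs in `S¹ × {p₀}` near `0`
  have hflat : ∀ᶠ t in 𝓝 (0 : ℝ), (γ' t).2 = p₀ := by
    have hγc : Continuous γ := hγs.continuous
    have hγU : ∀ᶠ t in 𝓝 (0 : ℝ), γ t ∈ U := by
      refine hγc.continuousAt.preimage_mem_nhds ?_
      rw [hγ0]
      exact hU
    have hγ1 : ∀ᶠ t in 𝓝 (0 : ℝ), t ∈ Icc (-1 : ℝ) 1 := Icc_mem_nhds (by norm_num) (by norm_num)
    filter_upwards [hγU, hγ1] with t htU ht1
    have hrc : γ t ∈ range c := by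
      have : γ t ∈ γ '' Icc (-1) 1 ∩ U := ⟨⟨t, ht1, rfl⟩, htU⟩
      rw [← hUeq] at this
      exact this.1
    obtain ⟨s, hs⟩ := hrc
    show (Ψ₁ (γ t)).2 = p₀
    rw [← hs, hΨc]
  have hinj : Injective (mfderiv (𝓡 n) (𝓡 n)
      (fun x ↦ (e' x).2 : Metric.sphere (0 : EuclideanSpace ℝ (Fin (n + 1))) 1 →
        Metric.sphere (0 : EuclideanSpace ℝ (Fin (n + 1))) 1) x₀) :=
    injective_mfderiv_snd_comp_of_transverse he' hγ's hγ'imm hγ'tr hflat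
  -- ### sentence 3: the shear straightening over a tube
  obtain ⟨Θ, r, hr, -, hΘx₀, hΘeq⟩ := exists_shear_straightening he' hx₀' hcross' hinj
  refine ⟨Ψ₁.trans Θ, r, hr, isSmoothEmbedding_diffeomorph_comp_circleProdSphere _ he,
    (isConnected_compl_range_diffeomorph_comp_iff _ e).2 hconn, ?_, ?_⟩
  · rw [Diffeomorph.coe_trans, comp_apply]
    exact hΘx₀
  · have hcomp : (⇑(Ψ₁.trans Θ) ∘ e : Metric.sphere (0 : EuclideanSpace ℝ (Fin (n + 1))) 1 →
        Circle × Metric.sphere (0 : EuclideanSpace ℝ (Fin (n + 1))) 1) = Θ ∘ e' := by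
      rw [Diffeomorph.coe_trans]
      rfl
    rw [hcomp]
    exact hΘeq

/-- **Reduction of Budney–Gabai Thm. 3.13 for `n ≥ 3` to the uniqueness of reducing balls.**  If,
for every `n ≥ 3`, every smoothly embedded non-separating `n`-sphere of `S¹ × Sⁿ` which meets a
closed tube `S¹ × B̄(p₀, r)` exactly in the flat disc `{1} × B̄(p₀, r)` is carried onto the standard
sphere `{1} × Sⁿ` by a diffeomorphism of `S¹ × Sⁿ` — this is Budney–Gabai's Thm. 3.12
(`Diff(S¹ × Bⁿ fix ∂)` acts transitively on the reducing balls of `S¹ × Bⁿ`) applied in the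
drilled manifold `S¹ × (Sⁿ ∖ B(p₀, r)) ≅ S¹ × Bⁿ` and extended by the identity over the tube —
then every smoothly embedded non-separating `n`-sphere of `S¹ × Sⁿ`, `n ≥ 3`, is carried onto
`{1} × Sⁿ` by a diffeomorphism (the standard-target form of Thm. 3.13, cf.
`BudneyGabai2019_thm_3_13_iff_forall_standardSphere`).  The hypothesis is the part of the printed
proof not formalized in this tree. [cite: BudneyGabai2019, Thm. 3.12 and proof of Thm. 3.13] -/
theorem exists_image_eq_range_standardSphere_of_reducingBall
    (Hred : ∀ k : ℕ, 3 ≤ k →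
      ∀ (f : Metric.sphere (0 : EuclideanSpace ℝ (Fin (k + 1))) 1 →
          Circle × Metric.sphere (0 : EuclideanSpace ℝ (Fin (k + 1))) 1)
        (p₀ : Metric.sphere (0 : EuclideanSpace ℝ (Fin (k + 1))) 1) (r : ℝ), 0 < r →
        Manifold.IsSmoothEmbedding (𝓡 k) ((𝓡 1).prod (𝓡 k)) ∞ f → IsConnected (range f)ᶜ →
        range f ∩ {q | q.2 ∈ closedBall p₀ r} = ({1} : Set Circle) ×ˢ closedBall p₀ r →
          ∃ Φ : (Circle × Metric.sphere (0 : EuclideanSpace ℝ (Fin (k + 1))) 1) ≃ₘ⟮(𝓡 1).prod (𝓡 k),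
              (𝓡 1).prod (𝓡 k)⟯ (Circle × Metric.sphere (0 : EuclideanSpace ℝ (Fin (k + 1))) 1),
            Φ '' range f = range (standardSphere k))
    (hn : 3 ≤ n)
    (e : Metric.sphere (0 : EuclideanSpace ℝ (Fin (n + 1))) 1 →
      Circle × Metric.sphere (0 : EuclideanSpace ℝ (Fin (n + 1))) 1)
    (he : Manifold.IsSmoothEmbedding (𝓡 n) ((𝓡 1).prod (𝓡 n)) ∞ e)
    (hconn : IsConnected (range e)ᶜ) :
    ∃ Φ : (Circle × Metric.sphere (0 : EuclideanSpace ℝ (Fin (n + 1))) 1) ≃ₘ⟮(𝓡 1).prod (𝓡 n),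
        (𝓡 1).prod (𝓡 n)⟯ (Circle × Metric.sphere (0 : EuclideanSpace ℝ (Fin (n + 1))) 1),
      Φ '' range e = range (standardSphere n) := by
  obtain ⟨x, hx⟩ : (Metric.sphere (0 : EuclideanSpace ℝ (Fin (n + 1))) 1).Nonempty :=
    NormedSpace.sphere_nonempty.2 zero_le_one
  obtain ⟨Ψ, r, hr, hΨe, hΨconn, -, hflat⟩ :=
    exists_diffeomorph_flat_over_tube hn he hconn ⟨x, hx⟩ ⟨x, hx⟩
  obtain ⟨Φ, hΦ⟩ := Hred n hn (Ψ ∘ e) ⟨x, hx⟩ r hr hΨe hΨconn hflat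
  refine ⟨Ψ.trans Φ, ?_⟩
  rw [Diffeomorph.coe_trans, image_comp, ← range_comp]
  exact hΦ

end BudneyGabai2019_thm_3_13

end Literature.Topology.FourManifolds

end
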